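import Summits.HubbardSuperconductivity.HubbardSuperconductivity.Theorems.AnisotropyChordSpinMonotoneTwoMagnonRookGraph
import Literature.Combinatorics.SimpleGraph.LovaszThetaEdgeTransitive

/-!
# Route `AnisotropyChord`: the rook graph `K_m □ K_n` with `m ≠ n` is NOT edge-transitive
# (why the rook two-magnon rung is beyond the one-contact-orbit theorem)

`twoMagnon_condensate_monotone_of_edgeTransitive` (`…TwoMagnonEdgeTransitive`) covers connected
vertex- AND edge-transitive graphs; the rook rung (`…TwoMagnonRook`) covers `K_{|α|} □ K_{|β|}`.
Here we certify that the latter is new territory: for `|α| ≠ |β|` (both `≥ 2`) the rook graph is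
not edge-transitive (`rook_not_isEdgeTransitive`) — an automorphism preserves the number of common
neighbours of the two ends of an edge, which is `|α| − 2` for a row edge and `|β| − 2` for a column
edge (`rook_commonNeighbours_row`, `rook_commonNeighbours_col`, `commonNeighbours_map_iso`).
No definition is introduced.
-/

set_option linter.dupNamespace false

noncomputable section

namespace Summit.HubbardSuperconductivity.HubbardSuperconductivity.Theorems.AnisotropyChord.TwoMagnon

open Matrix Complex Finset
open Literature.Combinatorics.SimpleGraph.LovaszThetaEdgeTransitive (IsEdgeTransitive)

variable {α β : Type*} [Fintype α] [DecidableEq α] [Fintype β] [DecidableEq β]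

/-- The number of common neighbours (as a complex number, `Σ_z [x ∼ z][y ∼ z]`) is invariant under
graph automorphisms. [folklore] -/
theorem commonNeighbours_map_iso {V : Type*} [Fintype V] {G : SimpleGraph V} [DecidableRel G.Adj]
    (φ : G ≃g G) (x y : V) :
    (∑ z, if G.Adj (φ x) z ∧ G.Adj (φ y) z then (1 : ℂ) else 0) =
      ∑ z, if G.Adj x z ∧ G.Adj y z then (1 : ℂ) else 0 := by
  refine (Fintype.sum_equiv φ.toEquiv _ _ fun z => ?_).symm
  have h1 : G.Adj (φ x) (φ.toEquiv z) ↔ G.Adj x z := φ.map_rel_iff'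
  have h2 : G.Adj (φ y) (φ.toEquiv z) ↔ G.Adj y z := φ.map_rel_iff'
  simp only [h1, h2]

section Rook

variable {G : SimpleGraph (α × β)} [DecidableRel G.Adj]

/-- On the rook graph the two ends of a ROW edge have `|α| − 2` common neighbours. [folklore] -/
theorem rook_commonNeighbours_row
    (hadj : ∀ x y : α × β, G.Adj x y ↔ (x.1 ≠ y.1 ∧ x.2 = y.2) ∨ (x.1 = y.1 ∧ x.2 ≠ y.2))
    {a₀ a₁ : α} (hα : a₀ ≠ a₁) (b₀ : β) :
    (∑ z, if G.Adj (a₀, b₀) z ∧ G.Adj (a₁, b₀) z then (1 : ℂ) else 0) =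
      (Fintype.card α : ℂ) - 2 := by
  have hrw : ∀ z, (if G.Adj (a₀, b₀) z ∧ G.Adj (a₁, b₀) z then (1 : ℂ) else 0) =
      if G.Adj (a₀, b₀) z then (if G.Adj (a₁, b₀) z then 1 else 0) else 0 := by
    intro z
    by_cases h1 : G.Adj (a₀, b₀) z
    · by_cases h2 : G.Adj (a₁, b₀) z
      · simp [h1, h2]
      · simp [h1, h2]
    · simp [h1]
  simp_rw [hrw]
  rw [rook_sum_adj hadj (a₀, b₀)]
  have e1 : ∀ a : α, (if a = a₀ then (0 : ℂ) else if G.Adj (a₁, b₀) (a, b₀) then 1 else 0) =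
      if a = a₀ ∨ a = a₁ then 0 else 1 := by
    intro a
    by_cases ha : a = a₀
    · simp [ha]
    · by_cases ha' : a = a₁
      · subst ha'
        simp [ha]
      · have h : G.Adj (a₁, b₀) (a, b₀) := (hadj _ _).2 (Or.inl ⟨fun h => ha' h.symm, rfl⟩)
        rw [if_neg ha, if_pos h, if_neg (not_or.mpr ⟨ha, ha'⟩)]
  have e2 : ∀ b : β, (if b = b₀ then (0 : ℂ) else if G.Adj (a₁, b₀) (a₀, b) then 1 else 0) = 0 := by
    intro b
    by_cases hb : b = b₀
    · simp [hb]
    · have h : ¬ G.Adj (a₁, b₀) (a₀, b) := by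
        rw [hadj]; push Not
        exact ⟨fun _ h' => absurd h'.symm hb, fun h' => absurd h'.symm hα⟩
      rw [if_neg hb, if_neg h]
  simp_rw [e1, e2]
  rw [sum_ite_or_eq_else hα 1, Finset.sum_const_zero, mul_one, add_zero]

/-- On the rook graph the two ends of a COLUMN edge have `|β| − 2` common neighbours. [folklore] -/
theorem rook_commonNeighbours_col
    (hadj : ∀ x y : α × β, G.Adj x y ↔ (x.1 ≠ y.1 ∧ x.2 = y.2) ∨ (x.1 = y.1 ∧ x.2 ≠ y.2))
    (a₀ : α) {b₀ b₁ : β} (hβ : b₀ ≠ b₁) :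
    (∑ z, if G.Adj (a₀, b₀) z ∧ G.Adj (a₀, b₁) z then (1 : ℂ) else 0) =
      (Fintype.card β : ℂ) - 2 := by
  have hrw : ∀ z, (if G.Adj (a₀, b₀) z ∧ G.Adj (a₀, b₁) z then (1 : ℂ) else 0) =
      if G.Adj (a₀, b₀) z then (if G.Adj (a₀, b₁) z then 1 else 0) else 0 := by
    intro z
    by_cases h1 : G.Adj (a₀, b₀) z
    · by_cases h2 : G.Adj (a₀, b₁) z
      · simp [h1, h2]
      · simp [h1, h2]
    · simp [h1]
  simp_rw [hrw]
  rw [rook_sum_adj hadj (a₀, b₀)]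
  have e1 : ∀ a : α, (if a = a₀ then (0 : ℂ) else if G.Adj (a₀, b₁) (a, b₀) then 1 else 0) = 0 := by
    intro a
    by_cases ha : a = a₀
    · simp [ha]
    · have h : ¬ G.Adj (a₀, b₁) (a, b₀) := by
        rw [hadj]; push Not
        exact ⟨fun _ h' => absurd h' hβ.symm, fun h' => absurd h'.symm ha⟩
      rw [if_neg ha, if_neg h]
  have e2 : ∀ b : β, (if b = b₀ then (0 : ℂ) else if G.Adj (a₀, b₁) (a₀, b) then 1 else 0) =
      if b = b₀ ∨ b = b₁ then 0 else 1 := by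
    intro b
    by_cases hb : b = b₀
    · simp [hb]
    · by_cases hb' : b = b₁
      · subst hb'
        simp [hb]
      · have h : G.Adj (a₀, b₁) (a₀, b) := (hadj _ _).2 (Or.inr ⟨rfl, fun h => hb' h.symm⟩)
        rw [if_neg hb, if_pos h, if_neg (not_or.mpr ⟨hb, hb'⟩)]
  simp_rw [e1, e2]
  rw [sum_ite_or_eq_else hβ 1, Finset.sum_const_zero, mul_one, zero_add]

/-- **The rook graph `K_{|α|} □ K_{|β|}` with `|α| ≠ |β|` (both `≥ 2`) is NOT edge-transitive**:
row edges and column edges lie in different `Aut`-orbits (common-neighbour counts `|α| − 2` vs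
`|β| − 2`).  So the rook two-magnon rung is outside the scope of the one-contact-orbit theorem
`twoMagnon_condensate_monotone_of_edgeTransitive`. [folklore] -/
theorem rook_not_isEdgeTransitive
    (hadj : ∀ x y : α × β, G.Adj x y ↔ (x.1 ≠ y.1 ∧ x.2 = y.2) ∨ (x.1 = y.1 ∧ x.2 ≠ y.2))
    {a₀ a₁ : α} (hα : a₀ ≠ a₁) {b₀ b₁ : β} (hβ : b₀ ≠ b₁)
    (hne : Fintype.card α ≠ Fintype.card β) : ¬ IsEdgeTransitive G := by
  intro hET
  have hrow : G.Adj (a₀, b₀) (a₁, b₀) := (hadj _ _).2 (Or.inl ⟨hα, rfl⟩)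
  have hcol : G.Adj (a₀, b₀) (a₀, b₁) := (hadj _ _).2 (Or.inr ⟨rfl, hβ⟩)
  obtain ⟨φ, hφ⟩ := hET hrow hcol
  have hr := rook_commonNeighbours_row (G := G) hadj hα b₀
  have hc := rook_commonNeighbours_col (G := G) hadj a₀ hβ
  have hinv := commonNeighbours_map_iso φ (a₀, b₀) (a₁, b₀)
  have key : (Fintype.card α : ℂ) - 2 = (Fintype.card β : ℂ) - 2 := by
    rw [← hr, ← hinv]
    rcases hφ with ⟨h1, h2⟩ | ⟨h1, h2⟩
    · rw [h1, h2, hc]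
    · rw [h1, h2, ← hc]
      refine Finset.sum_congr rfl fun z _ => ?_
      simp only [and_comm]
  have : (Fintype.card α : ℂ) = Fintype.card β := by linear_combination key
  exact hne (by exact_mod_cast this)

end Rook

end Summit.HubbardSuperconductivity.HubbardSuperconductivity.Theorems.AnisotropyChord.TwoMagnon
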